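import Summits.PneNP.PneNP.Theses.SzkEntropy
import Summits.PneNP.PneNP.Theorems.SzkEntropyPeaWorstToAvg
import Summits.PneNP.PneNP.Theorems.SzkEntropyPeaThreeNotInPKillSwitch
import Summits.PneNP.PneNP.Theorems.SzkEntropyCookModelBridge
import Summits.PneNP.PneNP.Theorems.SzkEntropyPhCollapse
import Literature.Computability.Complexity.PolynomialEntropyApproximation
import Literature.Computability.Complexity.PromiseZPPProofs

/-!
# PneNP / SzkEntropy — crux `PeaWorstToAvg` (stmt-PneNP-10777), negative side: what a disproof entails

Route `PneNP/SzkEntropy`, crux item stmt-PneNP-10777 (`PeaWorstToAvg`, rank 3, "hardest / most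
informative", OPEN):

  `PEA 3 ∉ PromiseBPP' → ∃ D samplable, supported on the promise, with ((PEA 3).yes, D) ∉ HeurBPP`.

This file is the LOAD-BEARING ANALYSIS of the standing disprover (`Cruxes/PeaWorstToAvg/Disproof.lean`,
§1–§3), landed as negative knowledge for ideators, planners and the lead.  The crux has exactly one
hypothesis; we prove what its NEGATION is and entails, and what mutating the hypothesis does:

* `szkEntropy_not_peaWorstToAvg_iff` — `¬ PeaWorstToAvg` is EXACTLY "`PEA 3 ∉ PromiseBPP'` and every
  polynomial-time samplable on-promise ensemble is `HeurBPP`-easy" (an `SZK`-Heuristica for `PEA₃`);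
* `szkEntropy_not_peaWorstToAvg_imp_peaThreeNotInP` — hence a disproof proves the route's thesis X
  (`PromiseP ⊆ PromiseBPP'`, proved tree fact) and refutes the kill switch
  (`szkEntropy_not_peaWorstToAvg_imp_not_peaThreeMemBPP`);
* `szkEntropy_not_peaWorstToAvg_closes` / `szkEntropy_not_peaWorstToAvg_imp_pneNP_of_peaMemPH` — and,
  with the one printed support `PeaMemPH`, proves the summit through the certified deciding theorem
  `closes` (the other two supports are proved tree theorems).  So no refutation of the crux exists
  short of `P ≠ NP`;
* `szkEntropy_peaWorstToAvg_withoutHyp_imp` — DROPPING the hypothesis leaves unconditional average-case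
  hardness, which already implies `¬ PeaThreeMemBPP`, X and the crux (converse direction);
* `szkEntropy_peaWorstToAvg_detHyp_iff` — WEAKENING the hypothesis to the deterministic
  `PEA 3 ∉ PromiseP` gives a statement equivalent to the crux PLUS promise-derandomisation for `PEA₃`
  (`PEA 3 ∈ PromiseBPP' → PEA 3 ∈ PromiseP`), the surplus being discharged under a `2^{εn}`-hard
  language in `E` (`szkEntropy_peaWorstToAvg_detHyp_iff_of_avgHard_E`, Nisan–Wigderson, proved tree
  theorem): the `BPP'` antecedent is the right one.

References: Z. Dvir, D. Gutfreund, G. N. Rothblum, S. Vadhan, *On approximating the entropy of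
polynomial mappings*, ICS 2011 (ECCC TR10-160), pp. 2–3 and Thm 1.1; A. Bogdanov, L. Trevisan,
*Average-Case Complexity* (2006), §2.3, Def. 2.12–2.13; R. Impagliazzo, *A personal view of
average-case complexity*, CCC 1995, §2; N. Nisan, A. Wigderson, *Hardness vs randomness*, JCSS 49
(1994), Thm 3; O. Goldreich, *On promise problems* (2006), Def. 1.2.
-/

namespace Summit.PneNP.PneNP.Theorems

open Literature.Computability.Complexity Literature.Computability.MetaComplexity
open Summit.PneNP.PneNP.Theses.SzkEntropy Filter

/-- **The negation of the crux is an `SZK`-Heuristica for `PEA₃`.** `¬ PeaWorstToAvg` holds iff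
`PEA 3 ∉ PromiseBPP'` AND every polynomial-time samplable ensemble supported on the promise makes
`((PEA 3).yes, D)` a member of `HeurBPP`. [Impagliazzo1995, §2; DvirGutfreundRothblumVadhan2010,
pp. 2–3; BogdanovTrevisan2006, Def. 2.12–2.13] -/
theorem szkEntropy_not_peaWorstToAvg_iff :
    ¬ PeaWorstToAvg ↔
      (PEA 3 ∉ PromiseBPP' ∧ ∀ D : Ensemble, D.IsPolySamplable →
        (∀ n : ℕ, ∀ w ∈ (D n).support, w ∈ (PEA 3).yes ∨ w ∈ (PEA 3).no) →
          (⟨(PEA 3).yes, D⟩ : DistProblem) ∈ HeurBPP) := by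
  rw [szkEntropy_peaWorstToAvg_iff]
  constructor
  · intro h
    obtain ⟨h1, h2⟩ := Classical.not_imp.1 h
    refine ⟨h1, fun D hS hsupp => ?_⟩
    by_contra hD
    exact h2 ⟨D, hS, hsupp, hD⟩
  · rintro ⟨h1, h2⟩ h
    obtain ⟨D, hS, hsupp, hD⟩ := h h1
    exact hD (h2 D hS hsupp)

/-- A disproof of the crux proves its hypothesis `PEA 3 ∉ PromiseBPP'`, i.e. refutes the kill switch
`PeaThreeMemBPP`. [DvirGutfreundRothblumVadhan2010, §4.4] -/
theorem szkEntropy_not_peaWorstToAvg_imp_not_peaThreeMemBPP (h : ¬ PeaWorstToAvg) :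
    ¬ PeaThreeMemBPP :=
  fun h3 => (szkEntropy_not_peaWorstToAvg_iff.1 h).1 (szkEntropy_peaThreeMemBPP_iff.1 h3)

/-- **A disproof of the crux proves the route's thesis X** (`PEA 3 ∉ PromiseP`), through the proved
inclusion `PromiseP ⊆ PromiseBPP'`. [Gill1977, Prop. 5.1; DvirGutfreundRothblumVadhan2010, Thm 1.1] -/
theorem szkEntropy_not_peaWorstToAvg_imp_peaThreeNotInP (h : ¬ PeaWorstToAvg) : PeaThreeNotInP :=
  szkEntropy_peaThreeNotInP_of_not_peaThreeMemBPP (szkEntropy_not_peaWorstToAvg_imp_not_peaThreeMemBPP h)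

/-- **A disproof of the crux proves the summit given the route's three supports**, via the certified
deciding theorem `closes`. [DvirGutfreundRothblumVadhan2010, Thm 1.1; AroraBarakCC2009, Thm 5.4] -/
theorem szkEntropy_not_peaWorstToAvg_closes (h : ¬ PeaWorstToAvg) (hPH : PeaMemPH) (hC : PhCollapse)
    (hB : CookModelBridge) : _root_.PneNP :=
  closes (szkEntropy_not_peaWorstToAvg_imp_peaThreeNotInP h) hPH hC hB

/-- **A disproof plus the one printed support `PeaMemPH` proves `P ≠ NP`** (`PhCollapse` and
`CookModelBridge` are the proved tree theorems `szkEntropy_phCollapse_proof`, `cookModelBridge_proof`).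
[DvirGutfreundRothblumVadhan2010, Thm 1.1 and Lemma 4.9; AroraBarakCC2009, Thm 5.4] -/
theorem szkEntropy_not_peaWorstToAvg_imp_pneNP_of_peaMemPH (h : ¬ PeaWorstToAvg) (hPH : PeaMemPH) :
    _root_.PneNP :=
  szkEntropy_not_peaWorstToAvg_closes h hPH szkEntropy_phCollapse_proof cookModelBridge_proof

/-- The crux/thesis dichotomy `PeaWorstToAvg ∨ PeaThreeNotInP` holds outright. [folklore] -/
theorem szkEntropy_peaWorstToAvg_or_peaThreeNotInP : PeaWorstToAvg ∨ PeaThreeNotInP := by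
  by_cases h : PeaWorstToAvg
  · exact Or.inl h
  · exact Or.inr (szkEntropy_not_peaWorstToAvg_imp_peaThreeNotInP h)

/-- **Dropping the hypothesis**: unconditional average-case hardness of `PEA₃` on a samplable
on-promise ensemble already implies `¬ PeaThreeMemBPP`, thesis X, and the crux itself (the converse
direction `szkEntropy_peaWorstToAvg_converse`). [Ostrovsky1991; BogdanovTrevisan2006, §2.3] -/
theorem szkEntropy_peaWorstToAvg_withoutHyp_imp
    (h : ∃ D : Ensemble, D.IsPolySamplable ∧
      (∀ n : ℕ, ∀ w ∈ (D n).support, w ∈ (PEA 3).yes ∨ w ∈ (PEA 3).no) ∧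
      (⟨(PEA 3).yes, D⟩ : DistProblem) ∉ HeurBPP) :
    ¬ PeaThreeMemBPP ∧ PeaThreeNotInP ∧ PeaWorstToAvg := by
  have h1 : PEA 3 ∉ PromiseBPP' := szkEntropy_peaWorstToAvg_converse h
  have h2 : ¬ PeaThreeMemBPP := fun h3 => h1 (szkEntropy_peaThreeMemBPP_iff.1 h3)
  exact ⟨h2, szkEntropy_peaThreeNotInP_of_not_peaThreeMemBPP h2,
    szkEntropy_peaWorstToAvg_iff.2 fun _ => h⟩

/-- **Weakening the hypothesis to `PEA 3 ∉ PromiseP` adds exactly promise-derandomisation.** The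
deterministic-hypothesis version of the crux is equivalent to
`PeaWorstToAvg ∧ (PEA 3 ∈ PromiseBPP' → PEA 3 ∈ PromiseP)`: were `PEA₃ ∈ prBPP' ∖ prP`, every
on-promise ensemble would be easy (`mem_HeurBPP_of_mem_PromiseBPP'`) and the `P`-version would fail while
the crux held vacuously. [BogdanovTrevisan2006, §2.3; Goldreich2006, Def. 1.2] -/
theorem szkEntropy_peaWorstToAvg_detHyp_iff :
    (PEA 3 ∉ PromiseP → ∃ D : Ensemble, D.IsPolySamplable ∧
        (∀ n : ℕ, ∀ w ∈ (D n).support, w ∈ (PEA 3).yes ∨ w ∈ (PEA 3).no) ∧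
        (⟨(PEA 3).yes, D⟩ : DistProblem) ∉ HeurBPP) ↔
      PeaWorstToAvg ∧ (PEA 3 ∈ PromiseBPP' → PEA 3 ∈ PromiseP) := by
  constructor
  · intro h
    refine ⟨szkEntropy_peaWorstToAvg_iff.2 fun hB => h fun hP => hB (PromiseP_subset_PromiseBPP' hP),
      fun hB => ?_⟩
    by_contra hP
    obtain ⟨D, -, hsupp, hD⟩ := h hP
    exact hD (mem_HeurBPP_of_mem_PromiseBPP' (PEA_disjoint 3) hB D hsupp)
  · rintro ⟨hc, hd⟩ hP
    exact szkEntropy_peaWorstToAvg_iff.1 hc fun hB => hP (hd hB)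

/-- **Under a `2^{εn}`-average-case-hard language in `E` the two versions coincide**, the
derandomisation conjunct being the proved tree theorem `PromiseBPP'_subset_PromiseP_of_avgHard_E`.
[NisanWigderson1994, Thm 3; ImpagliazzoWigderson1997, Thm 2] -/
theorem szkEntropy_peaWorstToAvg_detHyp_iff_of_avgHard_E {L : Language Bool} (hL : L ∈ E) {ε : ℝ}
    (hε : 0 < ε) (hhard : ∀ᶠ n in atTop, AvgHardAtLeast (L.sliceFn n) ((2 : ℝ) ^ (ε * n))) :
    (PEA 3 ∉ PromiseP → ∃ D : Ensemble, D.IsPolySamplable ∧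
        (∀ n : ℕ, ∀ w ∈ (D n).support, w ∈ (PEA 3).yes ∨ w ∈ (PEA 3).no) ∧
        (⟨(PEA 3).yes, D⟩ : DistProblem) ∉ HeurBPP) ↔ PeaWorstToAvg := by
  rw [szkEntropy_peaWorstToAvg_detHyp_iff]
  exact ⟨fun h => h.1,
    fun h => ⟨h, fun hB => PromiseBPP'_subset_PromiseP_of_avgHard_E hL hε hhard hB⟩⟩

end Summit.PneNP.PneNP.Theorems
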